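/-
Origin: expansion seat `planner-pub-hodgecm-pv03-g5-0`, handover #4 2026-08-18T09:33:55Z (`HOME/pub-hodgecm-pv03-g5/lean/Pv03g5/ThetaModel3.lean`, md5 efcb1f9e, 257 lines);
landed by the gen-7 packager in gate run 27 as `HodgeCM/Model/ToyG2/ThetaModel3.lean` (import ^import Pv03g5\.→import HodgeCM.Model.ToyG2. ×1).
-/
import Mathlib
import Summits.HodgeConjecture.HodgeCM.Model.ToyG2.ThetaGram_4
import Summits.HodgeConjecture.HodgeCM.Model.ToyG2.Isolation
import Summits.HodgeConjecture.HodgeCM.Proofs.LevelDirected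
import Summits.HodgeConjecture.HodgeCM.StubTree.Combinatorics
import Summits.HodgeConjecture.HodgeCM.CM.Lemmas
import Summits.HodgeConjecture.HodgeCM.Assembly.CorCM

/-!
# (R3-b) The theta realisation of the period leaf: `RealisationExistsPerL` holds in `toyUniverse₃ d t`

Companion of `ThetaUiso` (R2-a), `ThetaPeriod` (R1) and `ThetaGram` (R3-a); realisation `R` of toy-g2's
DESIGN.md §4.  For the period leaf `P(L, ι₁)` of the generation-2 toy universe on good objects
`toyUniverse₃ d t` (`1 ≤ d`, `t² = 16`) this file CONSTRUCTS the theta realisation data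
`(toyUniverse₃ d t).ThetaRealisation ι₁ V K Ψ σ` of `HodgeCM.Automorphic.Realisation` for every seesaw
context admitted by PerL Thm 4.4 / rfwf Thm 4.1 — an embedding `j : K →+* L` with `ι₁ ∘ j = σ`, a pair-sum
quadruple of CM types `Ψ` of `K` all containing `σ`, any hermitian 3-space `V` — and derives the two OPEN INPUTS

* `realisationExistsPerL₃ : (toyUniverse₃ d t).RealisationExistsPerL`
* `realisationExistsFace₃ : (toyUniverse₃ d t).RealisationExistsFace`

of `HodgeCM.StubTree.Inputs` for this universe, with no hypothesis beyond `(hd : 1 ≤ d) (ht : t ^ 2 = 16)`;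
hence toy-g2's G4 target `∃ U, U.ModelAxioms ∧ U.RealisationExistsPerL ∧ U.RealisationExistsFace` modulo the one
open model axiom M26 (`g4_witness_of_gysin`, from `toyUniverse₃_modelAxioms_of_gysin`), and, GIVEN M26, the
package's end-to-end theorems inside the model: `endState₃_of_gysin : … → PerL ∧ PeriodThmF ∧ W_RK4`
(`HodgeCM.Assembly.perL/periodThmF/w_rk4`).

The data (`thetaRealisation₃`):
* `HG = CG := HG L ι₁ = ℓ²(∐_q (W ⊕ Fin 3 × E))` (R3-a), `H := ℂ`, `G = SK = SigIdx = SigIdxG := Unit`;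
* `S := ToyG2.lineSetting v` (toy-g2 `Isolation`), the one-line isolation setting on the THETA VECTOR
  `v := Λ(E_{q₀,2,θ₀}, E_{q₀,3,θ₀})`, where `q₀` is the block of the quadruple induced from `Ψ` along `j`
  (`ThetaUiso.qInd`) and `θ₀ := embOf L ι₁` is `ι₁` transported to the presentation `FK L` — `θ₀` is holomorphic
  for all four types of block `q₀` (`embOf_hol`), so `v ≠ 0` (`Λ_theta23_ne_zero`, R3-a §6);
* `Λ Γ := ThetaUiso.Λ ι₁ d t hd ht` (R3-a), level-independent; `Theta i Γ := {E_{q₀,i,θ₀}}`;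
* `Theta_sub` = single eigenvectors are isotypic (`eCls_mem_uiso₃`, R2-a);
* `lineField`, `gen12` = the kernel relation `Λ(E₀, E₁) = (β₀/α₀) • v` with `β₀/α₀ ≠ 0`
  (`Λ_theta01_eq_smul`, toy-g2 `BlockData.β_zero_ne_zero`/`α_pos`) and `S₁₂ = ℂ ∙ v`;
* `real34` = `ϑ χ Φ = v` is itself a (2,3) theta wedge, hence in the span, hence in its closure;
* `cover := idMor`, `Λ_cover` = `pull id = id` (toy-g2 `fact3_pull_id`); `level_inf` = tree `levelDirected`;
* `inner_Λ := ⟨1/4, _, inner_Λ₃⟩` — the Gram identity of R3-a.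

WHAT THIS SHOWS / DOES NOT SHOW.  It shows that the realisation interface of the package — the fields of
`ThetaRealisation` as they stand since gen 7 (existential `lineField`, closure-form `real34`, `inner_Λ` with a
nonzero constant, `Theta_sub` into the CM-isotypic part `Uiso`) — is satisfied, for ALL contexts quantified in
`RealisationExistsPerL` / `RealisationExistsFace`, by ONE explicit model in which nothing degenerates: the theta
sets are nonempty, the theta wedges are nonzero, `S₁₂ = ℂ ∙ v` with `v ≠ 0` (`thetaRealisation₃_S12`), and the
period side is the genuine quadrilinear period of the model (`inner_Λ₃`, `c = 1/4`).  It does NOT assert anything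
about theta series on actual Picard modular surfaces: the two inputs remain OPEN for the intended universe; this
file certifies their joint satisfiability with the R1/R2-a structure (`H10_eq_span₃`, `eCls_mem_uiso₃`,
`cup_eCls_ne_zero₃`) in the generation-2 toy universe, i.e. the model-theoretic half of toy-g2 DESIGN.md §4.

Everything is kernel-proved from the tree; no citation, nothing posited.
-/

noncomputable section

open scoped TensorProduct InnerProductSpace
open HodgeCM.Toy HodgeCM.Toy.CMPresentation HodgeCM.ToyG2
open Literature.AlgebraicGeometry.Motives

namespace HodgeCM.ToyG2.ThetaUiso

/-! ### 1. The block, the theta classes and the theta vector of a seesaw context -/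

section Data

variable (d t : ℚ) {K L : CMField} (ι₁ : L →+* ℂ) (hd : (1 : ℚ) ≤ d) (ht : t ^ 2 = 16)
  (j : K →+* L) (Ψ : Fin 4 → CMType K) (hP : PairSum Ψ) (hm : ∀ i, ι₁.comp j ∈ (Ψ i).1)

/-- the block `q₀ ∈ Q(L, ι₁)` of the quadruple induced from `Ψ` along `j` -/
def qΨ : Fin (nQ L ι₁) := eQ L ι₁ (qInd ι₁ j Ψ hP hm)

/-- `θ₀ := embOf L ι₁` (the transported `ι₁`) is holomorphic for all four types of block `q₀` -/
theorem embOf_hol (i : Fin 4) :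
    (embOf L ι₁).comp (eK L : L →+* FK L) ∈ (ΘOf L ι₁ (qΨ ι₁ j Ψ hP hm) i).1 := by
  rw [embOf_comp, qΨ, ΘOf_eQ_qInd, mem_indType_iff]
  exact hm i

/-- the theta class of slot `i`: the single eigenvector `E_{q₀, i, θ₀}` of `H¹(P(L, ι₁), ℂ)` -/
def thetaE (i : Fin 4) : V1 ι₁ d t := eCls ι₁ d t (qΨ ι₁ j Ψ hP hm) i (embOf L ι₁)

/-- the theta vector `v := Λ(E_{q₀,2,θ₀}, E_{q₀,3,θ₀}) ∈ HG` -/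
def thetaV : HG L ι₁ :=
  Λ ι₁ d t hd ht (thetaE d t ι₁ j Ψ hP hm 2) (thetaE d t ι₁ j Ψ hP hm 3)

open scoped Classical in
/-- the kernel-relation constant `κ := β₀(θ₀)/α₀(θ₀)` of block `q₀` -/
def κΨ : ℂ :=
  (((blockData ι₁ d t hd ht (qΨ ι₁ j Ψ hP hm)).β 0 (embOf L ι₁)
      / (blockData ι₁ d t hd ht (qΨ ι₁ j Ψ hP hm)).α 0 (embOf L ι₁) : ℝ) : ℂ)

/-- **the theta vector is nonzero** -/
theorem thetaV_ne_zero : thetaV d t ι₁ hd ht j Ψ hP hm ≠ 0 :=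
  Λ_theta23_ne_zero ι₁ d t (qΨ ι₁ j Ψ hP hm) hd ht (embOf_hol ι₁ j Ψ hP hm 0) (embOf_hol ι₁ j Ψ hP hm 1)
    (embOf_hol ι₁ j Ψ hP hm 2) (embOf_hol ι₁ j Ψ hP hm 3)

/-- **the kernel relation**: `Λ(E₀, E₁) = κ • v` -/
theorem Λ_thetaE01 :
    Λ ι₁ d t hd ht (thetaE d t ι₁ j Ψ hP hm 0) (thetaE d t ι₁ j Ψ hP hm 1)
      = κΨ d t ι₁ hd ht j Ψ hP hm • thetaV d t ι₁ hd ht j Ψ hP hm :=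
  Λ_theta01_eq_smul ι₁ d t (qΨ ι₁ j Ψ hP hm) hd ht (embOf_hol ι₁ j Ψ hP hm 0) (embOf_hol ι₁ j Ψ hP hm 1)
    (embOf_hol ι₁ j Ψ hP hm 2) (embOf_hol ι₁ j Ψ hP hm 3)

open scoped Classical in
/-- `κ ≠ 0` -/
theorem κΨ_ne_zero : κΨ d t ι₁ hd ht j Ψ hP hm ≠ 0 := by
  have hP0 : (blockData ι₁ d t hd ht (qΨ ι₁ j Ψ hP hm)).P 0 (embOf L ι₁) :=
    P_zero_of_hol ι₁ d t (qΨ ι₁ j Ψ hP hm) hd ht (embOf_hol ι₁ j Ψ hP hm 0) (embOf_hol ι₁ j Ψ hP hm 1)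
      (embOf_hol ι₁ j Ψ hP hm 2) (embOf_hol ι₁ j Ψ hP hm 3)
  exact Complex.ofReal_ne_zero.mpr
    (div_ne_zero (BlockData.β_zero_ne_zero _ hP0) (BlockData.α_pos _ hP0).ne')

/-- **the (0,1) theta wedge is nonzero** (the line field of Prop 4.3 in the model) -/
theorem Λ_thetaE01_ne_zero :
    Λ ι₁ d t hd ht (thetaE d t ι₁ j Ψ hP hm 0) (thetaE d t ι₁ j Ψ hP hm 1) ≠ 0 := by
  rw [Λ_thetaE01]
  exact smul_ne_zero (κΨ_ne_zero d t ι₁ hd ht j Ψ hP hm) (thetaV_ne_zero d t ι₁ hd ht j Ψ hP hm)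

/-- pull-back along the identity of the period surface is the identity (level change in the model) -/
theorem pullC_idMor_pms₃ {V : HermSpace3 L ι₁} (Γ Γ' : Level V)
    (ω : (toyUniverse₃ d t).CohC ((toyUniverse₃ d t).pms L ι₁ V Γ) 1) :
    (toyUniverse₃ d t).pullC (X := (toyUniverse₃ d t).pms L ι₁ V Γ') (Y := (toyUniverse₃ d t).pms L ι₁ V Γ)
        ((toyUniverse₃ d t).idMor ((toyUniverse₃ d t).pms L ι₁ V Γ)) 1 ω = ω := by
  have h : (toyUniverse₃ d t).pull ((toyUniverse₃ d t).idMor ((toyUniverse₃ d t).pms L ι₁ V Γ)) 1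
      = LinearMap.id :=
    fact3_pull_id exteriorHodgeData traceSys (gplOf d t) _ 1
  show ((toyUniverse₃ d t).pull ((toyUniverse₃ d t).idMor ((toyUniverse₃ d t).pms L ι₁ V Γ)) 1).baseChange ℂ ω = ω
  rw [h, LinearMap.baseChange_id, LinearMap.id_apply]

end Data

/-! ### 2. The theta realisation -/

section Model

variable (d t : ℚ) {K L : CMField} (ι₁ : L →+* ℂ) (hd : (1 : ℚ) ≤ d) (ht : t ^ 2 = 16)
  (j : K →+* L) (Ψ : Fin 4 → CMType K) (hP : PairSum Ψ) {σ : K →+* ℂ} (hι : ι₁.comp j = σ)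
  (hσ : ∀ i, σ ∈ (Ψ i).1) (V : HermSpace3 L ι₁)

include hι in
/-- `σ = ι₁ ∘ j` lies in all four types, restated for `ι₁ ∘ j` -/
theorem hm_of (hσ : ∀ i, σ ∈ (Ψ i).1) : ∀ i, ι₁.comp j ∈ (Ψ i).1 := fun i => by
  rw [hι]; exact hσ i

/-- **The theta realisation of the period leaf of `toyUniverse₃ d t`** at the seesaw context
`(K, Ψ, σ)`, `σ = ι₁ ∘ j`, for any hermitian 3-space `V`. -/
def thetaRealisation₃ : (toyUniverse₃ d t).ThetaRealisation ι₁ V K Ψ σ where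
  H := ℂ
  HG := HG L ι₁
  CG := HG L ι₁
  G := Unit
  SK := Unit
  SigIdx := Unit
  SigIdxG := Unit
  S := lineSetting (thetaV d t ι₁ hd ht j Ψ hP (hm_of ι₁ j Ψ hι hσ))
  Λ := fun _ => Λ ι₁ d t hd ht
  Theta := fun i _ => {thetaE d t ι₁ j Ψ hP (hm_of ι₁ j Ψ hι hσ) i}
  Theta_sub := by
    intro i Γ ω hω
    rw [Set.mem_singleton_iff.mp hω]
    exact eCls_mem_uiso₃ d t ι₁ _ i j (Ψ i) Γ (hσ i) (ΘOf_eQ_qInd ι₁ j Ψ hP (hm_of ι₁ j Ψ hι hσ) i)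
      (by rw [embOf_comp_jT, hι])
  lineField := by
    obtain ⟨Γ⟩ := Level.nonempty V
    exact ⟨Γ, _, Set.mem_singleton _, _, Set.mem_singleton _,
      Λ_thetaE01_ne_zero d t ι₁ hd ht j Ψ hP (hm_of ι₁ j Ψ hι hσ)⟩
  gen12 := by
    intro Γ ω₁ ω₂ h₁ h₂
    rw [Set.mem_singleton_iff.mp h₁, Set.mem_singleton_iff.mp h₂]
    exact (mem_lineSetting_S12_iff _ _).mpr ⟨κΨ d t ι₁ hd ht j Ψ hP (hm_of ι₁ j Ψ hι hσ),
      (Λ_thetaE01 d t ι₁ hd ht j Ψ hP (hm_of ι₁ j Ψ hι hσ)).symm⟩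
  real34 := by
    intro χ _ Φ
    obtain ⟨Γ⟩ := Level.nonempty V
    rw [lineSetting_ϑ34]
    exact Submodule.le_topologicalClosure _
      (Submodule.subset_span ⟨Γ, _, Set.mem_singleton _, _, Set.mem_singleton _, rfl⟩)
  cover := fun Γ _ _ => (toyUniverse₃ d t).idMor ((toyUniverse₃ d t).pms L ι₁ V Γ)
  Λ_cover := by
    intro Γ Γ' h ω ω'
    rw [pullC_idMor_pms₃, pullC_idMor_pms₃]
  level_inf := fun Γ₁ Γ₂ => levelDirected L ι₁ V Γ₁ Γ₂
  inner_Λ := fun Γ => ⟨1 / 4, by norm_num, fun ω hω => inner_Λ₃ d t ι₁ Γ hd ht ω hω⟩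

include hd ht hP hι hσ in
/-- the realisation data exist -/
theorem nonempty_thetaRealisation₃ : Nonempty ((toyUniverse₃ d t).ThetaRealisation ι₁ V K Ψ σ) :=
  ⟨thetaRealisation₃ d t ι₁ hd ht j Ψ hP hι hσ V⟩

/-- its `S₁₂` is the line through the (nonzero) theta vector — the realisation is not degenerate -/
theorem thetaRealisation₃_S12 :
    (thetaRealisation₃ d t ι₁ hd ht j Ψ hP hι hσ V).S.t12.S12
        = ℂ ∙ thetaV d t ι₁ hd ht j Ψ hP (hm_of ι₁ j Ψ hι hσ)
      ∧ thetaV d t ι₁ hd ht j Ψ hP (hm_of ι₁ j Ψ hι hσ) ≠ 0 :=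
  ⟨lineSetting_S12 _, thetaV_ne_zero d t ι₁ hd ht j Ψ hP _⟩

end Model

/-! ### 3. The two open realisation inputs hold in `toyUniverse₃ d t` -/

section Inputs

variable (d t : ℚ) (hd : (1 : ℚ) ≤ d) (ht : t ^ 2 = 16)
include hd ht

/-- **`RealisationExistsPerL` holds in the generation-2 toy universe on good objects**: for PerL's data the
types are pair-sum (`StubTree.pairSum_of_isPerLTypes`) and all contain `φ₁ = ι₁|_K` (sign table, column 1). -/
theorem realisationExistsPerL₃ : (toyUniverse₃ d t).RealisationExistsPerL := by
  intro K L j _ hK _ φ hφ ι₁ hι₁ Ψ hΨ V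
  have hmem : ∀ i, φ 0 ∈ (Ψ i).1 := fun i => (hΨ i 0).mpr (by fin_cases i <;> rfl)
  exact ⟨thetaRealisation₃ d t ι₁ hd ht j Ψ (StubTree.pairSum_of_isPerLTypes K φ hφ hK Ψ hΨ) hι₁ hmem V⟩

/-- **`RealisationExistsFace` holds in the generation-2 toy universe on good objects**: `K = L = F`, `j = id`,
types `f.psi` (`pairSum_psi`), `σ = ι₁ ∈ ψ_i` (`admissible_mem_psi`). -/
theorem realisationExistsFace₃ : (toyUniverse₃ d t).RealisationExistsFace := by
  intro F _ _ f ι₁ hadm V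
  exact ⟨thetaRealisation₃ d t ι₁ hd ht (RingHom.id F) f.psi (pairSum_psi f) (RingHom.comp_id ι₁)
    (admissible_mem_psi f ι₁ hadm) V⟩

/-- both at once, in the shape of `HodgeCM.Universe.OpenInputs` -/
theorem realisationExists₃ :
    (toyUniverse₃ d t).RealisationExistsPerL ∧ (toyUniverse₃ d t).RealisationExistsFace :=
  ⟨realisationExistsPerL₃ d t hd ht, realisationExistsFace₃ d t hd ht⟩

/-! ### 4. toy-g2's G4 target (DESIGN.md §0), modulo the one open model axiom M26 (Gysin for good surfaces) -/

/-- `ModelAxioms ∧ RealisationExistsPerL ∧ RealisationExistsFace` for `toyUniverse₃ d t`, GIVEN M26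
(`toyUniverse₃_modelAxioms_of_gysin`, 27 of 28 model axioms being theorems of toy-g2's `Universe3`). -/
theorem g4_of_gysin (h26 : (toyUniverse₃ d t).Fact_gysin_surface) :
    (toyUniverse₃ d t).ModelAxioms ∧ (toyUniverse₃ d t).RealisationExistsPerL
      ∧ (toyUniverse₃ d t).RealisationExistsFace :=
  ⟨toyUniverse₃_modelAxioms_of_gysin d t h26, realisationExistsPerL₃ d t hd ht, realisationExistsFace₃ d t hd ht⟩

omit hd ht in
/-- the G4 consistency witness `∃ U, U.ModelAxioms ∧ U.RealisationExistsPerL ∧ U.RealisationExistsFace` at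
`d = 1`, `t = 4`, GIVEN M26 for `toyUniverse₃ 1 4` -/
theorem g4_witness_of_gysin (h26 : (toyUniverse₃ 1 4).Fact_gysin_surface) :
    ∃ U : Universe, U.ModelAxioms ∧ U.RealisationExistsPerL ∧ U.RealisationExistsFace :=
  ⟨toyUniverse₃ 1 4, g4_of_gysin 1 4 le_rfl (by norm_num) h26⟩

/-! ### 5. The package's end-to-end theorems applied to the model (GIVEN M26) -/

/-- in `toyUniverse₃ d t`, GIVEN M26: PerL's `W_per^L` (`Universe.PerL`), rfwf Thm 4.1 (`PeriodThmF`) and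
`W^{RK4}` hold — `HodgeCM.Assembly.perL` / `periodThmF` / `w_rk4` (model axioms + the realisation inputs ⇒ the
period theorems) instantiated at the model's axioms (`toyUniverse₃_modelAxioms_of_gysin`) and at the
realisations of §3.  This is the statement the G4 consistency charge tests inside the model. -/
theorem endState₃_of_gysin (h26 : (toyUniverse₃ d t).Fact_gysin_surface) :
    (toyUniverse₃ d t).PerL ∧ (toyUniverse₃ d t).PeriodThmF ∧ (toyUniverse₃ d t).W_RK4 :=
  have M := toyUniverse₃_modelAxioms_of_gysin d t h26
  ⟨Assembly.perL _ M (realisationExistsPerL₃ d t hd ht), Assembly.periodThmF _ M (realisationExistsFace₃ d t hd ht),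
    Assembly.w_rk4 _ M (realisationExistsFace₃ d t hd ht)⟩

end Inputs

end HodgeCM.ToyG2.ThetaUiso

end
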